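import Summits.BirchSwinnertonDyer.BirchSwinnertonDyer.Theses.TangentCone
import Literature.NumberTheory.EllipticCurves.IwasawaLeadingTermProofs
import Literature.Barriers.BirchSwinnertonDyer.SelmerVersusMordellWeilProofs
import Literature.NumberTheory.EllipticCurves.HeegnerPoints
import Literature.NumberTheory.EllipticCurves.HeegnerPointsOfConductor

/-!
# Crux `SelmerRankShaPFinite` (stmt-BirchSwinnertonDyer-0132) — line `Sketch` (idea `shadow-descent`):
# the lead's ELIGIBILITY AUDIT (cycle 1)

Lead seat `prover-line-stmt-BirchSwinnertonDyer-0132-0`, 2026-08-17. The only entry of `payload.lines`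
is `Sketch` = the crux-ideate seat's `Sketch.lean` for the idea `shadow-descent` (evidence
`20260817T063616Z-Sketch.lean`, note: "CapKilledBy / NoCap / FirstLemma … + DescentOutputShape; lean check
rc 0, 0 sorries"). That file is not mounted in the lead's jail (`run/gate/evidence/…`), so §1 re-elaborates
its typed content VERBATIM from the card `Ideas/shadow-descent.md` (§"First lemma"), and §2 types the
gap that makes the line ineligible for THIS crux as filed:

* the crux quantifies over every elliptic `W/ℚ` and EVERY prime `p`;
* the card's Transfer paragraph: `C⁺(E,p)` (= `NoCap ∧ NoSurv` for one admissible `K`) is equivalent to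
  the crux instance only on the sector `{2 ≤ r_an(E), 5 ≤ p, p good ordinary, ρ̄_{E,p} surjective}`
  (`ShadowSectorOutput` below), with five residual sectors (supersingular, multiplicative, additive,
  `p ∈ {2,3}`, CM / small image) and the `r_an ≤ 1` sector (GZK leaf, an unproved tree fact) outside its
  `Leans on:`;
* hence any composition `… → SelmerRankShaPFinite` built on this line must carry, as a stub, the crux
  restricted to the residual sectors — e.g. the `2`-primary Tate–Shafarevich conjecture for every
  elliptic curve over `ℚ`, which by the tree's dictionary is "every `2^∞`-Selmer corank is realised by
  rational points" (`residualAtTwo_iff_selmerCorank_two_le_rank`), an open statement no part of the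
  line addresses (`residual_of_any_composition`).

Nothing here is a stub or a composition theorem; the file is evidence for `Lines/Sketch.dead.md`.
-/

set_option linter.dupNamespace false

namespace Summit.BirchSwinnertonDyer.BirchSwinnertonDyer.Cruxes.SelmerRankShaPFinite.SketchAudit

open Summit.BirchSwinnertonDyer.BirchSwinnertonDyer.Theses.TangentCone
open WeierstrassCurve Literature.NumberTheory.EllipticCurves

/-! ## §1 The card's typed content, re-elaborated verbatim (it concludes `NoCap`, never the crux) -/

/-- Card decl `CapKilledBy W K ι p c B`: every class of `Ш(W/K)` that capitulates in the ring class
field `K[c]` and is killed by some power of `p` is already killed by `p ^ B`. -/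
def CapKilledBy (W : WeierstrassCurve ℚ) (K : Type) [Field K] [NumberField K] (ι : K →+* ℂ)
    (p c B : ℕ) : Prop :=
  ∀ (k : ℕ) (x : (W.baseChange K).galH1), x ∈ (W.baseChange K).sha →
    (W.baseChange K).localRestrictionHom (ringClassField K ι c) x = 0 →
      ((p : ℤ) ^ k) • x = 0 → ((p : ℤ) ^ B) • x = 0

/-- Card decl `NoCap W K ι p`: bounded `p`-exponent of the capitulation kernels of `Ш(W/K)` in the
ring-class `p`-tower `K[p^n]`, uniformly in `n` (the card's "Cap = 0"). -/
def NoCap (W : WeierstrassCurve ℚ) (K : Type) [Field K] [NumberField K] (ι : K →+* ℂ) (p : ℕ) :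
    Prop :=
  ∃ B : ℕ, ∀ n : ℕ, CapKilledBy W K ι p (p ^ n) B

/-- Card decl `FirstLemma` (the idea's "first lemma"; by the card's own Transfer/Cheapest-falsifier
paragraphs an OPEN statement — half of the crux instance on the sector, given anticyclotomic control):
for globally minimal `W`, imaginary quadratic `K` with the Heegner hypothesis, `p ≥ 5` good ordinary
with `p ∤ N · d_K · h_K` and surjective `ρ̄_{E,p}`: `NoCap W K ι p`. Its conclusion is `NoCap`, not
`Finite Ш(W)[p^∞]`. -/
def FirstLemma : Prop :=
  ∀ (W : WeierstrassCurve ℚ) [W.IsElliptic] [W.IsGloballyMinimal] (K : Type) [Field K] [NumberField K]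
    (ι : K →+* ℂ) (p : ℕ) [Fact p.Prime], IsImaginaryQuadratic K →
    SatisfiesHeegnerHypothesis (W.conductorNorm ℤ) K → 5 ≤ p → W.HasGoodReductionAtPrime p →
    ¬ (p : ℤ) ∣ W.frobeniusTrace p →
    ¬ (p : ℤ) ∣ (W.conductorNorm ℤ : ℤ) * NumberField.discr K * (NumberField.classNumber K : ℤ) →
    W.HasSurjectiveModNGaloisRep p → NoCap W K ι p

/-- Sanity (the content of `CapKilledBy` is the uniformity of `B`, not the individual layer): the bound
is monotone in `B`. -/
theorem capKilledBy_mono {W : WeierstrassCurve ℚ} {K : Type} [Field K] [NumberField K] {ι : K →+* ℂ}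
    {p c B B' : ℕ} (h : CapKilledBy W K ι p c B) (hB : B ≤ B') : CapKilledBy W K ι p c B' := by
  intro k x hx hres hk
  have h0 : ((p : ℤ) ^ B) • x = 0 := h k x hx hres hk
  obtain ⟨d, rfl⟩ := Nat.exists_eq_add_of_le hB
  rw [pow_add, mul_comm, mul_smul, h0]
  exact zsmul_zero _

/-! ## §2 The sector the line's transfer reaches, and what it leaves out -/

/-- The output domain of the card's transfer `C⁺`: the crux instance on the sector
`{W globally minimal, 2 ≤ r_an(W), 5 ≤ p, p good ordinary, ρ̄_{W,p} surjective}` — exactly where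
`TangentCone.closes` consumes `hSha` (at the cone prime), but NOT the crux. -/
def ShadowSectorOutput : Prop :=
  ∀ (W : WeierstrassCurve ℚ) [W.IsElliptic] [W.IsGloballyMinimal] (p : ℕ) [Fact p.Prime],
    2 ≤ W.analyticRank → 5 ≤ p → W.HasGoodReductionAtPrime p → ¬ (p : ℤ) ∣ W.frobeniusTrace p →
    W.HasSurjectiveModNGaloisRep p → Finite ↥(AddCommGroup.primaryComponent W.sha p)

/-- The crux gives the sector output (trivially). -/
theorem shadowSectorOutput_of_crux (h : SelmerRankShaPFinite) : ShadowSectorOutput :=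
  fun W _ _ p _ _ _ _ _ _ => h W p

/-- Smallest residual witness of the gap: the prime `2` (excluded by `5 ≤ p`) for EVERY curve — the
`2`-primary Tate–Shafarevich conjecture over `ℚ`. -/
def ResidualAtTwo : Prop :=
  ∀ (W : WeierstrassCurve ℚ) [W.IsElliptic], Finite ↥(AddCommGroup.primaryComponent W.sha 2)

/-- The crux contains the residual (trivially). -/
theorem residualAtTwo_of_crux (h : SelmerRankShaPFinite) : ResidualAtTwo :=
  fun W _ => h W 2

/-- Dictionary at `p = 2` (tree theorems only: Greenberg's identity
`selmerCorank_eq_mordellWeilRank_add_holds` and cofinite generation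
`finite_primaryComponent_sha_iff_shaCorank_eq_zero`): the residual is "every `2^∞`-Selmer corank of
every elliptic curve over `ℚ` is realised by rational points" — open, and untouched by a line that
works at `p ≥ 5` good ordinary. -/
theorem residualAtTwo_iff_selmerCorank_two_le_rank :
    ResidualAtTwo ↔ ∀ (W : WeierstrassCurve ℚ) [W.IsElliptic], W.selmerCorank 2 ≤ W.mordellWeilRank := by
  constructor
  · intro h W _
    have hf : W.shaCorank 2 = 0 := (finite_primaryComponent_sha_iff_shaCorank_eq_zero W 2).1 (h W)
    have hid : W.selmerCorank 2 = W.mordellWeilRank + W.shaCorank 2 :=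
      W.selmerCorank_eq_mordellWeilRank_add_holds 2
    omega
  · intro h W _
    rw [finite_primaryComponent_sha_iff_shaCorank_eq_zero W 2]
    have hid : W.selmerCorank 2 = W.mordellWeilRank + W.shaCorank 2 :=
      W.selmerCorank_eq_mordellWeilRank_add_holds 2
    have hle := h W
    omega

/-- **The eligibility gap, as an implication.** Whatever stub set closes the crux from the line's
sector output also proves that every `2^∞`-Selmer corank over `ℚ` is realised by points: a
`SelmerRankShaPFinite_of` for this line necessarily carries the crux on the residual sectors as a
stub (a costume of the crux, with no engine in the line's `Leans on:`). -/
theorem residual_of_any_composition (comp : ShadowSectorOutput → SelmerRankShaPFinite)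
    (hS : ShadowSectorOutput) :
    ∀ (W : WeierstrassCurve ℚ) [W.IsElliptic], W.selmerCorank 2 ≤ W.mordellWeilRank :=
  residualAtTwo_iff_selmerCorank_two_le_rank.1 (residualAtTwo_of_crux (comp hS))

/-- For the record (tree theorem `SelmerRankBarrierNarrow_holds`, conjunct 1): the converse
inequality `rank ≤ corank Sel_{2^∞}` always holds, so the residual at `2` is an EQUALITY of the
`2^∞`-Selmer corank with the rank for every curve. -/
theorem residualAtTwo_iff_selmerCorank_two_eq_rank :
    ResidualAtTwo ↔ ∀ (W : WeierstrassCurve ℚ) [W.IsElliptic], W.selmerCorank 2 = W.mordellWeilRank := by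
  rw [residualAtTwo_iff_selmerCorank_two_le_rank]
  refine ⟨fun h W _ => le_antisymm (h W) ?_, fun h W _ => (h W).le⟩
  exact (Literature.Barriers.BirchSwinnertonDyer.SelmerRankBarrierNarrow_holds ℚ W 2).1

end Summit.BirchSwinnertonDyer.BirchSwinnertonDyer.Cruxes.SelmerRankShaPFinite.SketchAudit
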